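import Mathlib
import Summits.Ventures.PercRepro2.LeafRowPendantRootSOSign
import Summits.Ventures.PercRepro2.SameClusterAvoid

/-!
# The second-order mirror (B)-term at a pendant root is nonnegative: `crossB′so ≥ 0`
(blind cell PercRepro2, p5 g30; `proofs/P5-OEDGE.md` §40 (4))

Theorem (B) for the mirror term reads `(Z − P(Q,vL))·crossB′ = Z²·s₁ + s₂·s₃` with three
theorem-signed slacks (BHK06 1.4 under the pair avoidance `{a₁ ↮ a₂, a₁ ↮ v}`, the
anticovariance `anticov(vL, bH)`, and the positive association of `v ∈ C₁`, `o ∈ C₁`).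
DIFFERENTIATING this certificate in the isolated-root direction (the second-order piece is the
directional derivative `(m₀·∇)` of the piece, `LeafRowPendantRootSO`) gives the division-free
identity (`crossB'so_certificate`, `ring`)

  `Z·(Z − vL)²·crossB′so = Z²·s₁·(Z(1 − π_v) + 2β) + Z³·(Z − vL)·s₁′ + Z·(Z − vL)·s₂′·s₃
                          + s₂·(s₃·β + Z²·(Z − vL)·B + (Z − vL)·α·β)`

with `s₁′ = (π_o − π_ov)(bH − vLbH) − (1 − π_v)(oLbH − vLoLbH)` (two steps of positive association
of the explored cluster `C(a₁)` under the avoidances `{a₂, v}` and `{v}`: `(Z − vL)·s₁′ ≥ 0`),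
`s₂′ = π_v·bH − vLbH` (a monotonicity slack), `α = π_o Z − oL`, `β = π_v Z − vL` (Harris),
`B = π_ov − π_o π_v` (Harris) — every term a product of nonnegative factors.  The degenerate
case `Z·(Z − vL)² = 0` is `Z = 0` (every `Q`-mass vanishes) or `π_v = 1` (Harris:
`Z(1 − π_v) ≤ Z − vL`), where `crossB′so = Z·vLbH·(π_o − π_ov) ≥ 0` directly.
Identity pre-checked as a free polynomial identity (own code `mining/p5/g30/sym/check_certB.py`) and
every factor census-nonnegative (196 / 196).  Own work; standard axioms.
-/

namespace Summit.Ventures.PercRepro2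

open UnionCluster CovForm CovForm.FirstOrder LeafStep LeafHalfCross LeafRowEdgeCubic
  LeafRowFirstOrderA LeafRowPendantRootFO LeafRowPendantRootSO

namespace LeafRowPendantRootMirrorB

section Slacks

variable {V : Type*} {E : Type*} [Fintype E] [DecidableEq E] [Fintype V] [DecidableEq V]
  {R : Type*} [Field R] [LinearOrder R] [IsStrictOrderedRing R]
variable (q : E → R) (ends : E → Sym2 V)

/-- **`s₁ ≥ 0`** — BHK06 Thm 1.4 under the pair avoidance `{a₁ ↮ a₂, a₁ ↮ v}`, the roots swapped
(`cross_pair_avoid`): `(P(Q,oL,bH) − P(Q,vL,oL,bH))·(Z − P(Q,vL)) ≤ (P(Q,oL) − P(Q,vL,oL))·(P(Q,bH) − P(Q,vL,bH))`. -/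
lemma s1_nonneg (hq : IsProbVec q) (o a₁ a₂ v b : V) :
    (prob q (avoidAll ends a₂ {a₁} ∩ (connEvent ends a₁ o ∩ connEvent ends a₂ b)) -
        prob q (avoidAll ends a₂ {a₁} ∩ (connEvent ends a₁ v ∩ (connEvent ends a₁ o ∩ connEvent ends a₂ b)))) *
      (prob q (avoidAll ends a₂ {a₁}) - prob q (avoidAll ends a₂ {a₁} ∩ connEvent ends a₁ v)) ≤
    (prob q (avoidAll ends a₂ {a₁} ∩ connEvent ends a₁ o) -
        prob q (avoidAll ends a₂ {a₁} ∩ (connEvent ends a₁ v ∩ connEvent ends a₁ o))) *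
      (prob q (avoidAll ends a₂ {a₁} ∩ connEvent ends a₂ b) -
        prob q (avoidAll ends a₂ {a₁} ∩ (connEvent ends a₁ v ∩ connEvent ends a₂ b))) := by
  have h := cross_pair_avoid q ends hq o a₂ a₁ v b
  rw [avoidAll_root_swap ends a₁ a₂] at h
  exact h

/-- **`s₃ ≥ 0`** — positive association of `v ∈ C₁`, `o ∈ C₁` under `Q` (BHK06 Thm 1.1 for the
cluster of `a₁`): `P(Q,oL)·P(Q,vL) ≤ Z·P(Q,vL,oL)`. -/
lemma s3_nonneg (hq : IsProbVec q) (o a₁ a₂ v : V) :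
    prob q (avoidAll ends a₂ {a₁} ∩ connEvent ends a₁ o) *
        prob q (avoidAll ends a₂ {a₁} ∩ connEvent ends a₁ v) ≤
      prob q (avoidAll ends a₂ {a₁}) *
        prob q (avoidAll ends a₂ {a₁} ∩ (connEvent ends a₁ v ∩ connEvent ends a₁ o)) := by
  have h := bhk_same_cluster_events q hq ends a₁ a₂ (isUpperSet_mem_setOf v) (isUpperSet_mem_setOf o)
  rw [← connEvent_eq_clusterInEvent ends a₁ v, ← connEvent_eq_clusterInEvent ends a₁ o,
    connEvent_comm ends a₁ a₂, ← Q_eq_compl_conn] at h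
  have e1 : connEvent ends a₁ v ∩ avoidAll ends a₂ {a₁} = avoidAll ends a₂ {a₁} ∩ connEvent ends a₁ v :=
    Set.inter_comm _ _
  have e2 : connEvent ends a₁ o ∩ avoidAll ends a₂ {a₁} = avoidAll ends a₂ {a₁} ∩ connEvent ends a₁ o :=
    Set.inter_comm _ _
  have e3 : connEvent ends a₁ v ∩ connEvent ends a₁ o ∩ avoidAll ends a₂ {a₁} =
      avoidAll ends a₂ {a₁} ∩ (connEvent ends a₁ v ∩ connEvent ends a₁ o) := Set.inter_comm _ _
  rw [e1, e2, e3] at h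
  linarith

/-- **The second step behind `s₁′`** — positive association of the cluster of `a₁` under the
avoidance of `v`, for the events `o ∈ C₁` and `a₂ ∈ C₁`:
`(P(Q,oL) − P(Q,vL,oL))·(1 − π_v) ≤ (π_o − π_{vo})·(Z − P(Q,vL))`. -/
lemma step2 (hq : IsProbVec q) (o a₁ a₂ v : V) :
    (prob q (avoidAll ends a₂ {a₁} ∩ connEvent ends a₁ o) -
        prob q (avoidAll ends a₂ {a₁} ∩ (connEvent ends a₁ v ∩ connEvent ends a₁ o))) *
      (1 - prob q (connEvent ends a₁ v)) ≤
    (prob q (connEvent ends a₁ o) - prob q (connEvent ends a₁ v ∩ connEvent ends a₁ o)) *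
      (prob q (avoidAll ends a₂ {a₁}) - prob q (avoidAll ends a₂ {a₁} ∩ connEvent ends a₁ v)) := by
  have h := bhk_same_cluster_events_avoid q hq ends a₁ {v}
    (isUpperSet_mem_setOf o) (isUpperSet_mem_setOf a₂)
  have eU : clusterInEvent ends a₁ ({W : Set V | o ∈ W} ∩ {W | a₂ ∈ W}) =
      connEvent ends a₁ o ∩ connEvent ends a₁ a₂ := by
    ext ω; simp only [Set.mem_inter_iff, mem_connEvent, clusterInEvent, Set.mem_setOf_eq, mem_cluster]
  have eA : avoidAll ends a₁ {v} = (connEvent ends a₁ v)ᶜ := Q_eq_compl_conn ends v a₁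
  rw [← connEvent_eq_clusterInEvent ends a₁ o, ← connEvent_eq_clusterInEvent ends a₁ a₂, eU, eA] at h
  have cQ : (connEvent ends a₁ a₂)ᶜ = avoidAll ends a₂ {a₁} := by
    rw [connEvent_comm ends a₁ a₂, ← Q_eq_compl_conn]
  -- the four masses of `h` in the vocabulary of the statement
  have hA : prob q (connEvent ends a₁ o ∩ (connEvent ends a₁ v)ᶜ) =
      prob q (connEvent ends a₁ o) - prob q (connEvent ends a₁ v ∩ connEvent ends a₁ o) := by
    have m1 := prob_inter_add_prob_inter_compl q (connEvent ends a₁ o) (connEvent ends a₁ v)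
    rw [Set.inter_comm (connEvent ends a₁ o) (connEvent ends a₁ v)] at m1
    linarith
  have hD : prob q (connEvent ends a₁ v)ᶜ = 1 - prob q (connEvent ends a₁ v) := prob_compl q _
  have hB : prob q (connEvent ends a₁ a₂ ∩ (connEvent ends a₁ v)ᶜ) =
      (1 - prob q (avoidAll ends a₂ {a₁})) -
        (prob q (connEvent ends a₁ v) - prob q (avoidAll ends a₂ {a₁} ∩ connEvent ends a₁ v)) := by
    have m2 := prob_inter_add_prob_inter_compl q (connEvent ends a₁ a₂) (connEvent ends a₁ v)
    have m5 := prob_compl q (connEvent ends a₁ a₂)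
    have n1 := prob_inter_add_prob_inter_compl q (connEvent ends a₁ v) (connEvent ends a₁ a₂)
    rw [cQ] at m5 n1
    rw [Set.inter_comm (connEvent ends a₁ a₂) (connEvent ends a₁ v)] at m2
    rw [Set.inter_comm (connEvent ends a₁ v) (avoidAll ends a₂ {a₁})] at n1
    linarith
  have hC : prob q (connEvent ends a₁ o ∩ connEvent ends a₁ a₂ ∩ (connEvent ends a₁ v)ᶜ) =
      (prob q (connEvent ends a₁ o) - prob q (avoidAll ends a₂ {a₁} ∩ connEvent ends a₁ o)) -
        (prob q (connEvent ends a₁ v ∩ connEvent ends a₁ o) -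
          prob q (avoidAll ends a₂ {a₁} ∩ (connEvent ends a₁ v ∩ connEvent ends a₁ o))) := by
    have m3 := prob_inter_add_prob_inter_compl q (connEvent ends a₁ o ∩ connEvent ends a₁ a₂)
      (connEvent ends a₁ v)
    have n3 := prob_inter_add_prob_inter_compl q (connEvent ends a₁ o) (connEvent ends a₁ a₂)
    have n2 := prob_inter_add_prob_inter_compl q (connEvent ends a₁ v ∩ connEvent ends a₁ o)
      (connEvent ends a₁ a₂)
    rw [cQ] at n3 n2
    have g1 : connEvent ends a₁ o ∩ connEvent ends a₁ a₂ ∩ connEvent ends a₁ v =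
        connEvent ends a₁ v ∩ connEvent ends a₁ o ∩ connEvent ends a₁ a₂ := by
      ext ω; simp only [Set.mem_inter_iff]; tauto
    have g2 : connEvent ends a₁ v ∩ connEvent ends a₁ o ∩ avoidAll ends a₂ {a₁} =
        avoidAll ends a₂ {a₁} ∩ (connEvent ends a₁ v ∩ connEvent ends a₁ o) := Set.inter_comm _ _
    have g3 : connEvent ends a₁ o ∩ avoidAll ends a₂ {a₁} = avoidAll ends a₂ {a₁} ∩ connEvent ends a₁ o :=
      Set.inter_comm _ _
    rw [g1] at m3
    rw [g2] at n2
    rw [g3] at n3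
    linarith
  rw [hA, hB, hC, hD] at h
  linarith

/-- **`(Z − P(Q,vL))·s₁′ ≥ 0`** — the two steps of positive association combined. -/
lemma s1'_nonneg (hq : IsProbVec q) (o a₁ a₂ v b : V) :
    0 ≤ (prob q (avoidAll ends a₂ {a₁}) - prob q (avoidAll ends a₂ {a₁} ∩ connEvent ends a₁ v)) *
      ((prob q (connEvent ends a₁ o) - prob q (connEvent ends a₁ v ∩ connEvent ends a₁ o)) *
          (prob q (avoidAll ends a₂ {a₁} ∩ connEvent ends a₂ b) -
            prob q (avoidAll ends a₂ {a₁} ∩ (connEvent ends a₁ v ∩ connEvent ends a₂ b))) -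
        (1 - prob q (connEvent ends a₁ v)) *
          (prob q (avoidAll ends a₂ {a₁} ∩ (connEvent ends a₁ o ∩ connEvent ends a₂ b)) -
            prob q (avoidAll ends a₂ {a₁} ∩ (connEvent ends a₁ v ∩ (connEvent ends a₁ o ∩ connEvent ends a₂ b))))) := by
  have h1 := s1_nonneg q ends hq o a₁ a₂ v b
  have h2 := step2 q ends hq o a₁ a₂ v
  -- nonnegativity of the masses involved
  have hbH : 0 ≤ prob q (avoidAll ends a₂ {a₁} ∩ connEvent ends a₂ b) -
      prob q (avoidAll ends a₂ {a₁} ∩ (connEvent ends a₁ v ∩ connEvent ends a₂ b)) :=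
    sub_nonneg.2 (prob_mono hq fun ω h => ⟨h.1, h.2.2⟩)
  have hpv : 0 ≤ 1 - prob q (connEvent ends a₁ v) := by linarith [prob_le_one hq (connEvent ends a₁ v)]
  have hZv : 0 ≤ prob q (avoidAll ends a₂ {a₁}) - prob q (avoidAll ends a₂ {a₁} ∩ connEvent ends a₁ v) :=
    sub_nonneg.2 (prob_mono hq Set.inter_subset_left)
  nlinarith [mul_le_mul_of_nonneg_left h1 hpv, mul_le_mul_of_nonneg_left h2 hbH]

end Slacks

section Main

variable {V : Type*} {E : Type*} [Fintype E] [DecidableEq E] [Fintype V] [DecidableEq V]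
  {R : Type*} [Field R] [LinearOrder R] [IsStrictOrderedRing R]
variable (q : E → R) (ends : E → Sym2 V)

/-- The right-hand side of the differentiated certificate, as a term. -/
noncomputable def certRHS (o a₁ a₂ v b : V) : R :=
  prob q (avoidAll ends a₂ {a₁}) ^ 2 *
      ((prob q (avoidAll ends a₂ {a₁} ∩ connEvent ends a₁ o) -
            prob q (avoidAll ends a₂ {a₁} ∩ (connEvent ends a₁ v ∩ connEvent ends a₁ o))) *
          (prob q (avoidAll ends a₂ {a₁} ∩ connEvent ends a₂ b) -
            prob q (avoidAll ends a₂ {a₁} ∩ (connEvent ends a₁ v ∩ connEvent ends a₂ b))) -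
        (prob q (avoidAll ends a₂ {a₁} ∩ (connEvent ends a₁ o ∩ connEvent ends a₂ b)) -
            prob q (avoidAll ends a₂ {a₁} ∩ (connEvent ends a₁ v ∩ (connEvent ends a₁ o ∩ connEvent ends a₂ b)))) *
          (prob q (avoidAll ends a₂ {a₁}) - prob q (avoidAll ends a₂ {a₁} ∩ connEvent ends a₁ v))) *
      (prob q (avoidAll ends a₂ {a₁}) * (1 - prob q (connEvent ends a₁ v)) +
        2 * (prob q (connEvent ends a₁ v) * prob q (avoidAll ends a₂ {a₁}) -
          prob q (avoidAll ends a₂ {a₁} ∩ connEvent ends a₁ v))) +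
    prob q (avoidAll ends a₂ {a₁}) ^ 3 *
      ((prob q (avoidAll ends a₂ {a₁}) - prob q (avoidAll ends a₂ {a₁} ∩ connEvent ends a₁ v)) *
        ((prob q (connEvent ends a₁ o) - prob q (connEvent ends a₁ v ∩ connEvent ends a₁ o)) *
            (prob q (avoidAll ends a₂ {a₁} ∩ connEvent ends a₂ b) -
              prob q (avoidAll ends a₂ {a₁} ∩ (connEvent ends a₁ v ∩ connEvent ends a₂ b))) -
          (1 - prob q (connEvent ends a₁ v)) *
            (prob q (avoidAll ends a₂ {a₁} ∩ (connEvent ends a₁ o ∩ connEvent ends a₂ b)) -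
              prob q (avoidAll ends a₂ {a₁} ∩ (connEvent ends a₁ v ∩ (connEvent ends a₁ o ∩ connEvent ends a₂ b)))))) +
    prob q (avoidAll ends a₂ {a₁}) *
      (prob q (avoidAll ends a₂ {a₁}) - prob q (avoidAll ends a₂ {a₁} ∩ connEvent ends a₁ v)) *
      (prob q (connEvent ends a₁ v) * prob q (avoidAll ends a₂ {a₁} ∩ connEvent ends a₂ b) -
        prob q (avoidAll ends a₂ {a₁} ∩ (connEvent ends a₁ v ∩ connEvent ends a₂ b))) *
      (prob q (avoidAll ends a₂ {a₁}) *
          prob q (avoidAll ends a₂ {a₁} ∩ (connEvent ends a₁ v ∩ connEvent ends a₁ o)) -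
        prob q (avoidAll ends a₂ {a₁} ∩ connEvent ends a₁ o) *
          prob q (avoidAll ends a₂ {a₁} ∩ connEvent ends a₁ v)) +
    (prob q (avoidAll ends a₂ {a₁} ∩ connEvent ends a₁ v) * prob q (avoidAll ends a₂ {a₁} ∩ connEvent ends a₂ b) -
        prob q (avoidAll ends a₂ {a₁}) *
          prob q (avoidAll ends a₂ {a₁} ∩ (connEvent ends a₁ v ∩ connEvent ends a₂ b))) *
      ((prob q (avoidAll ends a₂ {a₁}) *
            prob q (avoidAll ends a₂ {a₁} ∩ (connEvent ends a₁ v ∩ connEvent ends a₁ o)) -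
          prob q (avoidAll ends a₂ {a₁} ∩ connEvent ends a₁ o) *
            prob q (avoidAll ends a₂ {a₁} ∩ connEvent ends a₁ v)) *
          (prob q (connEvent ends a₁ v) * prob q (avoidAll ends a₂ {a₁}) -
            prob q (avoidAll ends a₂ {a₁} ∩ connEvent ends a₁ v)) +
        prob q (avoidAll ends a₂ {a₁}) ^ 2 *
          (prob q (avoidAll ends a₂ {a₁}) - prob q (avoidAll ends a₂ {a₁} ∩ connEvent ends a₁ v)) *
          (prob q (connEvent ends a₁ v ∩ connEvent ends a₁ o) -
            prob q (connEvent ends a₁ o) * prob q (connEvent ends a₁ v)) +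
        (prob q (avoidAll ends a₂ {a₁}) - prob q (avoidAll ends a₂ {a₁} ∩ connEvent ends a₁ v)) *
          (prob q (connEvent ends a₁ o) * prob q (avoidAll ends a₂ {a₁}) -
            prob q (avoidAll ends a₂ {a₁} ∩ connEvent ends a₁ o)) *
          (prob q (connEvent ends a₁ v) * prob q (avoidAll ends a₂ {a₁}) -
            prob q (avoidAll ends a₂ {a₁} ∩ connEvent ends a₁ v)))

omit [Fintype V] [DecidableEq V] [LinearOrder R] [IsStrictOrderedRing R] in
/-- **The differentiated theorem-(B) certificate** (a polynomial identity):
`Z·(Z − vL)²·crossB′so = Z²·s₁·(Z(1 − π_v) + 2β) + Z³·(Z − vL)·s₁′ + Z·(Z − vL)·s₂′·s₃ + s₂·(s₃β + Z²(Z − vL)B + (Z − vL)αβ)`. -/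
lemma crossB'so_certificate (o a₁ a₂ v b : V) :
    prob q (avoidAll ends a₂ {a₁}) *
        (prob q (avoidAll ends a₂ {a₁}) - prob q (avoidAll ends a₂ {a₁} ∩ connEvent ends a₁ v)) ^ 2 *
        crossB'so q ends o a₁ a₂ v b = certRHS q ends o a₁ a₂ v b := by
  unfold crossB'so certRHS
  ring

/-- Every term of the certificate is a product of nonnegative factors. -/
lemma certRHS_nonneg (hq : IsProbVec q) (o a₁ a₂ v b : V) : 0 ≤ certRHS q ends o a₁ a₂ v b := by
  have hs1 := s1_nonneg q ends hq o a₁ a₂ v b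
  have hs3 := s3_nonneg q ends hq o a₁ a₂ v
  have hs1' := s1'_nonneg q ends hq o a₁ a₂ v b
  have hs2 := anticov_nonneg_of_cross q ends hq a₁ a₂ v b
  unfold anticov at hs2
  have hs2' := slack_nonneg q ends hq a₁ a₂ v {W | b ∈ W}
  rw [← connEvent_eq_clusterInEvent ends a₂ b,
    Set.inter_comm (connEvent ends a₂ b) (connEvent ends a₁ v)] at hs2'
  have hβ := slack_nonneg q ends hq a₁ a₂ v Set.univ
  rw [clusterInEvent_univ, Set.univ_inter, Set.inter_univ] at hβ
  have hα := slack_nonneg q ends hq a₁ a₂ o Set.univ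
  rw [clusterInEvent_univ, Set.univ_inter, Set.inter_univ] at hα
  have hB := prob_mul_prob_le_prob_inter hq (isUpperSet_connEvent ends a₁ v) (isUpperSet_connEvent ends a₁ o)
  have hZv : prob q (avoidAll ends a₂ {a₁} ∩ connEvent ends a₁ v) ≤ prob q (avoidAll ends a₂ {a₁}) :=
    prob_mono hq Set.inter_subset_left
  have hπv := prob_le_one hq (connEvent ends a₁ v)
  have hZ := prob_nonneg hq (avoidAll ends a₂ {a₁})
  have t1 : 0 ≤ prob q (avoidAll ends a₂ {a₁}) * (1 - prob q (connEvent ends a₁ v)) +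
      2 * (prob q (connEvent ends a₁ v) * prob q (avoidAll ends a₂ {a₁}) -
        prob q (avoidAll ends a₂ {a₁} ∩ connEvent ends a₁ v)) := by
    have := mul_nonneg hZ (sub_nonneg.2 hπv)
    linarith
  have t2 : 0 ≤ prob q (avoidAll ends a₂ {a₁}) - prob q (avoidAll ends a₂ {a₁} ∩ connEvent ends a₁ v) := by
    linarith
  unfold certRHS
  refine add_nonneg (add_nonneg (add_nonneg ?_ ?_) ?_) ?_
  · exact mul_nonneg (mul_nonneg (pow_nonneg hZ 2) (by linarith)) t1
  · exact mul_nonneg (pow_nonneg hZ 3) hs1'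
  · exact mul_nonneg (mul_nonneg (mul_nonneg hZ t2) (by linarith)) (by linarith)
  · refine mul_nonneg (by linarith) (add_nonneg (add_nonneg ?_ ?_) ?_)
    · exact mul_nonneg (by linarith) (by linarith)
    · exact mul_nonneg (mul_nonneg (pow_nonneg hZ 2) t2) (by linarith)
    · exact mul_nonneg (mul_nonneg t2 (by linarith)) (by linarith)

omit [Fintype V] [DecidableEq V] in
/-- The degenerate case `Z = 0`: every `Q`-mass vanishes and so does `crossB′so`. -/
lemma crossB'so_eq_zero_of_Z (hq : IsProbVec q) (o a₁ a₂ v b : V)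
    (hZ0 : prob q (avoidAll ends a₂ {a₁}) = 0) : crossB'so q ends o a₁ a₂ v b = 0 := by
  have z : ∀ X : Set (Config E), prob q (avoidAll ends a₂ {a₁} ∩ X) = 0 := fun X =>
    le_antisymm (by rw [← hZ0]; exact prob_mono hq Set.inter_subset_left) (prob_nonneg hq _)
  unfold crossB'so
  simp only [z, hZ0]
  ring

omit [Fintype V] [DecidableEq V] in
/-- A `¬vL`-mass vanishes when `P(Q, v ∉ C₁) = 0`. -/
lemma mass_eq_of_compl_zero (hq : IsProbVec q) (a₁ a₂ v : V) (X : Set (Config E))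
    (h0 : prob q (avoidAll ends a₂ {a₁} ∩ (connEvent ends a₁ v)ᶜ) = 0) :
    prob q (avoidAll ends a₂ {a₁} ∩ X) = prob q (avoidAll ends a₂ {a₁} ∩ (connEvent ends a₁ v ∩ X)) := by
  have h := prob_inter_add_prob_inter_compl q (avoidAll ends a₂ {a₁} ∩ X) (connEvent ends a₁ v)
  have hle : prob q (avoidAll ends a₂ {a₁} ∩ X ∩ (connEvent ends a₁ v)ᶜ) ≤
      prob q (avoidAll ends a₂ {a₁} ∩ (connEvent ends a₁ v)ᶜ) :=
    prob_mono hq fun ω hω => ⟨hω.1.1, hω.2⟩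
  have hnn := prob_nonneg hq (avoidAll ends a₂ {a₁} ∩ X ∩ (connEvent ends a₁ v)ᶜ)
  have es : avoidAll ends a₂ {a₁} ∩ X ∩ connEvent ends a₁ v =
      avoidAll ends a₂ {a₁} ∩ (connEvent ends a₁ v ∩ X) := by
    ext ω; simp only [Set.mem_inter_iff]; tauto
  rw [es] at h
  linarith

omit [Fintype V] [DecidableEq V] in
/-- The degenerate case `P(Q, vL) = Z` with `Z > 0`: then `π_v = 1` (Harris) and
`crossB′so = Z·P(Q,vL,bH)·(π_o − π_{vo}) ≥ 0`. -/
lemma crossB'so_nonneg_of_vL_eq (hq : IsProbVec q) (o a₁ a₂ v b : V)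
    (hZpos : 0 < prob q (avoidAll ends a₂ {a₁}))
    (heq : prob q (avoidAll ends a₂ {a₁} ∩ connEvent ends a₁ v) = prob q (avoidAll ends a₂ {a₁})) :
    0 ≤ crossB'so q ends o a₁ a₂ v b := by
  have hH := prob_mul_prob_le_prob_inter_of_isLowerSet hq
    ((isUpperSet_connEvent ends a₂ a₁).compl) ((isUpperSet_connEvent ends a₁ v).compl)
  rw [← Q_eq_compl_conn, prob_compl] at hH
  have hsplit := prob_inter_add_prob_inter_compl q (avoidAll ends a₂ {a₁}) (connEvent ends a₁ v)
  have hzero : prob q (avoidAll ends a₂ {a₁} ∩ (connEvent ends a₁ v)ᶜ) = 0 := by linarith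
  have hπv := prob_le_one hq (connEvent ends a₁ v)
  have hπv1 : prob q (connEvent ends a₁ v) = 1 := by
    rw [hzero] at hH
    by_contra hne
    have hlt : 1 - prob q (connEvent ends a₁ v) > 0 := by
      rcases lt_or_eq_of_le hπv with h | h
      · linarith
      · exact absurd h hne
    have := mul_pos hZpos hlt
    linarith
  have e1 := mass_eq_of_compl_zero q ends hq a₁ a₂ v (connEvent ends a₁ o) hzero
  have e2 := mass_eq_of_compl_zero q ends hq a₁ a₂ v (connEvent ends a₂ b) hzero
  have e3 := mass_eq_of_compl_zero q ends hq a₁ a₂ v (connEvent ends a₁ o ∩ connEvent ends a₂ b) hzero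
  have hZ := prob_nonneg hq (avoidAll ends a₂ {a₁})
  have hvLbH := prob_nonneg hq (avoidAll ends a₂ {a₁} ∩ (connEvent ends a₁ v ∩ connEvent ends a₂ b))
  have hπvo : prob q (connEvent ends a₁ v ∩ connEvent ends a₁ o) ≤ prob q (connEvent ends a₁ o) :=
    prob_mono hq Set.inter_subset_right
  have hint := mul_nonneg (mul_nonneg hZ hvLbH) (sub_nonneg.2 hπvo)
  unfold crossB'so
  rw [e1, e2, e3, heq, hπv1]
  linarith

/-- **THEOREM: `crossB′so ≥ 0`** — the second-order mirror (B)-term at a pendant root is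
nonnegative (the differentiated theorem-(B) certificate; degenerate cases by Harris). -/
theorem crossB'so_nonneg (hq : IsProbVec q) (o a₁ a₂ v b : V) :
    0 ≤ crossB'so q ends o a₁ a₂ v b := by
  have hZ := prob_nonneg hq (avoidAll ends a₂ {a₁})
  have hZv : prob q (avoidAll ends a₂ {a₁} ∩ connEvent ends a₁ v) ≤ prob q (avoidAll ends a₂ {a₁}) :=
    prob_mono hq Set.inter_subset_left
  rcases lt_or_eq_of_le hZ with hZpos | hZ0
  · rcases lt_or_eq_of_le hZv with hlt | heq
    · have hpos : 0 < prob q (avoidAll ends a₂ {a₁}) *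
          (prob q (avoidAll ends a₂ {a₁}) - prob q (avoidAll ends a₂ {a₁} ∩ connEvent ends a₁ v)) ^ 2 :=
        mul_pos hZpos (pow_pos (sub_pos.2 hlt) 2)
      have hR : 0 ≤ prob q (avoidAll ends a₂ {a₁}) *
          (prob q (avoidAll ends a₂ {a₁}) - prob q (avoidAll ends a₂ {a₁} ∩ connEvent ends a₁ v)) ^ 2 *
          crossB'so q ends o a₁ a₂ v b := by
        rw [crossB'so_certificate]
        exact certRHS_nonneg q ends hq o a₁ a₂ v b
      exact (mul_nonneg_iff_of_pos_left hpos).1 hR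
    · exact crossB'so_nonneg_of_vL_eq q ends hq o a₁ a₂ v b hZpos heq
  · rw [crossB'so_eq_zero_of_Z q ends hq o a₁ a₂ v b hZ0.symm]

end Main

section Assembly

variable {V : Type*} {E : Type*} [Fintype E] [DecidableEq E] [Fintype V] [DecidableEq V]
  {R : Type*} [Field R] [LinearOrder R] [IsStrictOrderedRing R]
variable {ends : E → Sym2 V} {p : E → R} {e : E} {a₂ z : V}

/-- **`B2h ≥ 0` at a pendant root, given the second-order mirror (A)-term**: with
`crossB'so_nonneg`, the sign of `crossA′so` at the open pin is all that `B2h ≥ 0` needs. -/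
theorem B2h_nonneg_pendant_root_of_crossA'so (hp : IsProbVec p) (he : p e ≠ 1)
    (hleaf : ∀ f, a₂ ∈ ends f → f = e) (hends : ends e = s(a₂, z)) {o a₁ v b : V}
    (ho : o ≠ a₂) (h1 : a₁ ≠ a₂) (hv : v ≠ a₂) (hb : b ≠ a₂)
    (hA : 0 ≤ crossA'so (Function.update p e 1) ends o a₁ a₂ v b) :
    0 ≤ B2h p ends o a₁ a₂ v b e := by
  have hq : IsProbVec (Function.update p e 1) := hp.update e zero_le_one le_rfl
  have hB := crossB'so_nonneg (Function.update p e 1) ends hq o a₁ a₂ v b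
  exact LeafRowPendantRootSOSign.B2h_nonneg_pendant_root_of_mirror hp he hleaf hends ho h1 hv hb
    (add_nonneg hA hB)

/-- **The degree-one-root contraction of row (LEAF-½) modulo the second-order mirror (A)-term**:
the row at the contraction `a₂ := z` and `0 ≤ crossA′so` at the open pin give the row at the
pendant instance, for every weight of the root edge. -/
theorem LeafRow_pendant_root_of_crossA'so (hp : IsProbVec p) (hleaf : ∀ f, a₂ ∈ ends f → f = e)
    (hends : ends e = s(a₂, z)) {o a₁ v b : V} (ho : o ≠ a₂) (h1 : a₁ ≠ a₂) (hv : v ≠ a₂) (hb : b ≠ a₂)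
    (hrow : LeafRow (Function.update p e 1) ends o a₁ a₂ v b)
    (hA : 0 ≤ crossA'so (Function.update p e 1) ends o a₁ a₂ v b) :
    LeafRow p ends o a₁ a₂ v b := by
  have hq : IsProbVec (Function.update p e 1) := hp.update e zero_le_one le_rfl
  have hB := crossB'so_nonneg (Function.update p e 1) ends hq o a₁ a₂ v b
  exact LeafRowPendantRootSOSign.LeafRow_pendant_root_of_mirror hp hleaf hends ho h1 hv hb hrow
    (add_nonneg hA hB)

end Assembly

end LeafRowPendantRootMirrorB

end Summit.Ventures.PercRepro2
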